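import Summits.KontsevichZagierPeriods.Zeta5Search.WedgeDictionaryLevelDescentVFullRecKInterior
import HarnessLib

/-!
# REC-K — the second-order recurrence of the kernel factor `K_μ = ldKer b μ` (WZ certificate summed, PROVED)

HONEST FRAMING: "systematic search; no irrationality claim unless certified".

CREDIT: the telescoper `p₂, p₁, p₀` and the WZ certificate were FOUND and verified exactly by the exactrec engine
(eng-exactrec-1, delivery F-zeta5-CT2, stage `zeta5ct-0.1`, MANIFEST e8bc5dda0b45603e; `recK_verify.py`); the cleared
polynomial identities `recK_interior_cleared` / `recK_col1_cleared` are the engine's `lean/RecKCertificate.lean` verbatim (`ring`).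
The cell's step is re-attaching the hypergeometric term (`kernel5_succ4`) and summing.
PLACEMENT (lead/lit g8, LITERATURE §I.50): `K_μ` is (a Pochhammer multiple of) a terminating very-well-poised ₇F₆(1); by
Whipple's transformation (Andrews–Askey–Roy, Special Functions, Thm 3.4.4) it is a terminating balanced ₄F₃(1) in which `μ`
moves contiguously, so an order-2 recurrence in `μ` exists a priori (Wilson 1977 / Raynal 1979 three-term relations, AAR §3.7);
REC-K is the EXPLICIT Wilson-type three-term relation with its WZ certificate, proved here from scratch.

  `ldKer_recK :  p₂(μ)·K_{μ+2} + p₁(μ)·K_{μ+1} + p₀(μ)·K_μ = 0`   (`μ ≥ 1`; `N ≥ 0`, `0 ≤ b_j ≤ N` for `j ∈ B`).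

This file: `K_μ = Σ_x F(μ,x)` (`ldKer_eq_sum_wzF`), the boundary columns `x = μ+1` (`recK_col1_cleared`, unit `wzUnitOne`)
and `x = μ+2` (definitional), the dispatch `wz_termwise`, and the telescoping sum.  Interior columns:
`WedgeDictionaryLevelDescentVFullRecKInterior`.  Exact cross-checks: pub-zeta5 g9 `e6_recK.py` (S 160/160), `e8_units.py`.
-/

open Finset

namespace Summit.KontsevichZagierPeriods.Zeta5Search.WedgeDictionary

open Summit.KontsevichZagierPeriods.Zeta5Search.DualSeries

/-- `K_μ = Σ_{x=1}^{n} F(μ,x)` for any `n ≥ μ`. -/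
theorem ldKer_eq_sum_wzF (b : ℕ → ℤ) (μ n : ℕ) (h : μ ≤ n) : ldKer b μ = ∑ x ∈ Icc 1 n, wzF b μ x := by
  have hsub : Icc 1 μ ⊆ Icc 1 n := Icc_subset_Icc le_rfl h
  rw [← sum_subset hsub (fun x hx hx' => by
    simp only [mem_Icc] at hx hx'
    rw [wzF, if_neg (by omega)])]
  unfold ldKer
  rw [mul_sum]
  refine sum_congr rfl fun x hx => ?_
  simp only [mem_Icc] at hx
  rw [wzF, if_pos ⟨hx.1, hx.2⟩]
  ring

/-! ### §3 The engine's cleared certificate identity, boundary column (eng-exactrec-1 `RecKCertificate.lean`, verbatim) -/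

set_option maxHeartbeats 4000000 in
/-- REC-K certificate, boundary column `x = μ+1` (cleared by `(2μ+N+3)(2μ+N+2)`; `ring`).  exactrec (eng-exactrec-1), zeta5ct-0.1. -/
theorem recK_col1_cleared {K : Type*} [Field K] (μ N b3 b4 b5 b6 : K) :
    let e1 := b3 + b4 + b5 + b6
    let e2 := b3*b4 + b3*b5 + b3*b6 + b4*b5 + b4*b6 + b5*b6
    let e3 := b3*b4*b5 + b3*b4*b6 + b3*b5*b6 + b4*b5*b6
    let p2 := (μ + N + 2 - b3) * (μ + N + 2 - b4) * (μ + N + 2 - b5) * (μ + N + 2 - b6)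
    let p1 := -2*μ^3 + (-6*N + 2*e1 - 8)*μ^2 + (-5*N^2 + 3*N*e1 - 15*N + 5*e1 - e2 - 11)*μ
              + (-N^3 + N^2*e1 - 5*N^2 + 3*N*e1 - N*e2 - 9*N + 3*e1 - e2 + e3 - 5)
    let T := 2*μ + N + 3
    let S := 2*μ + N + 2
    p2 * (μ + 1) * S + p1 * T * S
      - ( (μ + N + 2) * ((μ + 1 + b3) * (μ + 1 + b4) * (μ + 1 + b5) * (μ + 1 + b6))
          + μ * ((μ + 1 + N - b3) * (μ + 1 + N - b4) * (μ + 1 + N - b5) * (μ + 1 + N - b6)) * T ) = 0 := by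
  intro e1 e2 e3 p2 p1 T S
  simp only [e1, e2, e3, p2, p1, T, S]
  ring

/-! ### §4b The boundary columns -/

/-- The common unit of the column `x = μ+1` (`μ = m+1`): `(−1)^{m+1}k₅(m+2)/((m+N+3)_{m+2}·(2m+N+5)(2m+N+4))`. -/
def wzUnitOne (b : ℕ → ℤ) (m : ℕ) : ℚ :=
  ((-1 : ℚ) ^ (m + 1) * kernel5 b (m + 1 + 1)) /
    (pochQ ((m : ℚ) + 1 + 1 + b 0 + 1) (m + 1 + 1) * ((2 * ((m : ℚ) + 1) + b 0 + 3) * (2 * ((m : ℚ) + 1) + b 0 + 2)))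

section colone
variable (b : ℕ → ℤ) (hN : 0 ≤ b 0) (m : ℕ)
include hN

/-- `F(μ+1,μ+1)` over the unit. -/
theorem wzF_one11 : wzF b (m + 1 + 1) (m + 1 + 1) =
    wzUnitOne b m * ((2 * ((m : ℚ) + 1) + b 0 + 3) * (2 * ((m : ℚ) + 1) + b 0 + 2)) := by
  have hN' : (0 : ℚ) ≤ b 0 := by exact_mod_cast hN
  have hQ : 0 < pochQ ((m : ℚ) + 1 + 1 + b 0 + 1) (m + 1 + 1) := pochQ_pos (by positivity) _
  rw [wzF, if_pos ⟨by omega, by omega⟩, wzUnitOne]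
  have e1 : m + 1 + 1 - 1 = m + 1 := by omega
  have e2 : m + 1 + 1 - (m + 1 + 1) = 0 := by omega
  simp only [e1, e2, Nat.factorial_succ, Nat.factorial_zero]
  push_cast
  rw [div_mul_eq_mul_div, div_eq_div_iff (by positivity) (by positivity)]
  ring

/-- `F(μ+2,μ+1)` over the unit. -/
theorem wzF_one21 : wzF b (m + 1 + 1 + 1) (m + 1 + 1) = wzUnitOne b m * (((m : ℚ) + 1 + 1) * (2 * ((m : ℚ) + 1) + b 0 + 2)) := by
  have hN' : (0 : ℚ) ≤ b 0 := by exact_mod_cast hN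
  have hQ : 0 < pochQ ((m : ℚ) + 1 + 1 + b 0 + 1) (m + 1 + 1) := pochQ_pos (by positivity) _
  rw [wzF, if_pos ⟨by omega, by omega⟩, wzUnitOne]
  have e1 : m + 1 + 1 + 1 - 1 = m + 1 + 1 := by omega
  have e2 : m + 1 + 1 + 1 - (m + 1 + 1) = 0 + 1 := by omega
  simp only [e1, e2, Nat.add_sub_cancel, Nat.factorial_succ, Nat.factorial_zero]
  rw [pochQ_succ_right _ (m + 1 + 1)]
  push_cast
  rw [div_mul_eq_mul_div, div_eq_div_iff (by positivity) (by positivity)]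
  ring

/-- `G(μ,μ+1)` over the unit. -/
theorem wzG_one1 : wzG b (m + 1) (m + 1 + 1) = wzUnitOne b m * (-(((m : ℚ) + 1) *
    ((((m : ℚ) + 1 + 1) + b 0 - b 3) * (((m : ℚ) + 1 + 1) + b 0 - b 4) * (((m : ℚ) + 1 + 1) + b 0 - b 5) * (((m : ℚ) + 1 + 1) + b 0 - b 6)) *
      (2 * ((m : ℚ) + 1) + b 0 + 3))) := by
  have hN' : (0 : ℚ) ≤ b 0 := by exact_mod_cast hN
  have hQ : 0 < pochQ ((m : ℚ) + 1 + 1 + b 0 + 1) (m + 1 + 1) := pochQ_pos (by positivity) _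
  rw [wzG, if_pos ⟨by omega, by omega⟩, wzUnitOne]
  have e1 : m + 1 - 1 = m := by omega
  have e2 : m + 1 + 1 - 1 = m + 1 := by omega
  have e3 : m + 1 + 2 - (m + 1 + 1) = 0 + 1 := by omega
  simp only [e1, e2, e3, Nat.factorial_succ, Nat.factorial_zero]
  push_cast
  rw [div_mul_eq_mul_div, div_eq_div_iff (by positivity) (by positivity)]
  ring

/-- `G(μ,μ+2)` over the unit (kernel ratio at `x = μ+1` and the base shift; quartic `B`-products generalised). -/
theorem wzG_one2 (hB : ∀ j ∈ Icc 3 6, 0 ≤ b j ∧ b j ≤ b 0) : wzG b (m + 1) (m + 1 + 1 + 1) = wzUnitOne b m *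
    ((((m : ℚ) + 1) + b 0 + 2) * ((((m : ℚ) + 1 + 1) + b 3) * (((m : ℚ) + 1 + 1) + b 4) * (((m : ℚ) + 1 + 1) + b 5) * (((m : ℚ) + 1 + 1) + b 6))) := by
  have hN' : (0 : ℚ) ≤ b 0 := by exact_mod_cast hN
  have hQ : 0 < pochQ ((m : ℚ) + 1 + 1 + b 0 + 1) (m + 1 + 1) := pochQ_pos (by positivity) _
  have hQ' : 0 < pochQ ((m : ℚ) + 1 + 1 + 1 + b 0 + 1) (m + 1 + 1) := pochQ_pos (by positivity) _
  have h3' : (b 3 : ℚ) ≤ b 0 := by exact_mod_cast (hB 3 (by simp)).2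
  have h4' : (b 4 : ℚ) ≤ b 0 := by exact_mod_cast (hB 4 (by simp)).2
  have h5' : (b 5 : ℚ) ≤ b 0 := by exact_mod_cast (hB 5 (by simp)).2
  have h6' : (b 6 : ℚ) ≤ b 0 := by exact_mod_cast (hB 6 (by simp)).2
  have hA0 : (0 : ℚ) < ((m : ℚ) + 1 + 1 + b 0 + 1 - b 3) * ((m : ℚ) + 1 + 1 + b 0 + 1 - b 4) *
      ((m : ℚ) + 1 + 1 + b 0 + 1 - b 5) * ((m : ℚ) + 1 + 1 + b 0 + 1 - b 6) :=
    mul_pos (mul_pos (mul_pos (by linarith) (by linarith)) (by linarith)) (by linarith)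
  have hK := kernel5_succ4 b (m + 1 + 1) (by omega) hN hB
  push_cast at hK
  have hP : ((m : ℚ) + 1 + 1 + b 0 + 1) * pochQ ((m : ℚ) + 1 + 1 + 1 + b 0 + 1) (m + 1 + 1) =
      pochQ ((m : ℚ) + 1 + 1 + b 0 + 1) (m + 1 + 1) * (((m : ℚ) + 1 + 1 + b 0 + 1) + ((m : ℚ) + 1 + 1)) := by
    have h := pochQ_shift ((m : ℚ) + 1 + 1 + b 0 + 1) (m + 1 + 1)
    rw [show (m : ℚ) + 1 + 1 + b 0 + 1 + 1 = (m : ℚ) + 1 + 1 + 1 + b 0 + 1 by ring] at h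
    push_cast at h
    linear_combination h
  have hm : (2 * ((m : ℚ) + 1 + 1) + b 0) * (((m : ℚ) + 1 + 1 + b 0 + 1 - b 3) * ((m : ℚ) + 1 + 1 + b 0 + 1 - b 4) *
      ((m : ℚ) + 1 + 1 + b 0 + 1 - b 5) * ((m : ℚ) + 1 + 1 + b 0 + 1 - b 6)) * ((m : ℚ) + 1 + 1 + b 0 + 1) ≠ 0 :=
    (mul_pos (mul_pos (by positivity) hA0) (by positivity)).ne'
  rw [wzG, if_pos ⟨by omega, by omega⟩, wzUnitOne]
  have e1 : m + 1 - 1 = m := by omega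
  have e2 : m + 1 + 1 + 1 - 1 = m + 1 + 1 := by omega
  have e3 : m + 1 + 2 - (m + 1 + 1 + 1) = 0 := by omega
  simp only [e1, e2, e3, Nat.factorial_succ, Nat.factorial_zero]
  push_cast
  rw [show (m : ℚ) + 1 + 1 + 1 + b 0 - b 3 = (m : ℚ) + 1 + 1 + b 0 + 1 - b 3 by ring,
    show (m : ℚ) + 1 + 1 + 1 + b 0 - b 4 = (m : ℚ) + 1 + 1 + b 0 + 1 - b 4 by ring,
    show (m : ℚ) + 1 + 1 + 1 + b 0 - b 5 = (m : ℚ) + 1 + 1 + b 0 + 1 - b 5 by ring,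
    show (m : ℚ) + 1 + 1 + 1 + b 0 - b 6 = (m : ℚ) + 1 + 1 + b 0 + 1 - b 6 by ring,
    div_mul_eq_mul_div, div_eq_div_iff (by positivity) (by positivity)]
  apply mul_left_cancel₀ hm
  generalize ((m : ℚ) + 1 + 1 + b 0 + 1 - b 3) * ((m : ℚ) + 1 + 1 + b 0 + 1 - b 4) * ((m : ℚ) + 1 + 1 + b 0 + 1 - b 5) *
      ((m : ℚ) + 1 + 1 + b 0 + 1 - b 6) = A at hK ⊢
  generalize ((m : ℚ) + 1 + 1 + b 3) * ((m : ℚ) + 1 + 1 + b 4) * ((m : ℚ) + 1 + 1 + b 5) * ((m : ℚ) + 1 + 1 + b 6) = P at hK ⊢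
  linear_combination
    (((m : ℚ) + 1 + 1 + b 0 + 1) * (-(((m : ℚ) + 1) * (((m : ℚ) + 1 + 1 + 1) - 1) * A *
        ((m.factorial : ℚ) * (-1 : ℚ) ^ (m + 1 + 1)))) *
      (pochQ ((m : ℚ) + 1 + 1 + b 0 + 1) (m + 1 + 1) * ((2 * ((m : ℚ) + 1) + b 0 + 3) * (2 * ((m : ℚ) + 1) + b 0 + 2)))) * hK -
    ((2 * ((m : ℚ) + 1 + 1) + b 0) * A *
      (((-1 : ℚ) ^ (m + 1) * kernel5 b (m + 1 + 1)) * ((((m : ℚ) + 1) + b 0 + 2) * P)) *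
      ((2 * ((m : ℚ) + 1 + 1 + 1) + b 0) * (((m : ℚ) + 1 + 1) * (((m : ℚ) + 1) * (m.factorial : ℚ))) * 1)) * hP

/-- **Column `x = μ+1`** (`F(μ,x) = 0` there; `recK_col1_cleared`). -/
theorem wz_col_one (hB : ∀ j ∈ Icc 3 6, 0 ≤ b j ∧ b j ≤ b 0) :
    kerP2 b (m + 1) * wzF b (m + 1 + 2) (m + 1 + 1) + kerP1 b (m + 1) * wzF b (m + 1 + 1) (m + 1 + 1) +
        kerP0 b (m + 1) * wzF b (m + 1) (m + 1 + 1) = wzG b (m + 1) (m + 1 + 1 + 1) - wzG b (m + 1) (m + 1 + 1) := by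
  have hF0 : wzF b (m + 1) (m + 1 + 1) = 0 := by rw [wzF, if_neg (by omega)]
  rw [show m + 1 + 2 = m + 1 + 1 + 1 from rfl, wzF_one11 b hN, wzF_one21 b hN, hF0, wzG_one1 b hN, wzG_one2 b hN m hB]
  have h := recK_col1_cleared (K := ℚ) ((m : ℚ) + 1) (b 0) (b 3) (b 4) (b 5) (b 6)
  dsimp only at h
  simp only [kerP2, kerP1, kerP0, esB1, esB2, esB3]
  push_cast
  linear_combination wzUnitOne b m * h

/-- **Column `x = μ+2`** (only `F(μ+2,μ+2)` and `G(μ,μ+2)` are present; `p₂ = ∏(μ+N+2−b_j)` is definitional). -/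
theorem wz_col_two : kerP2 b (m + 1) * wzF b (m + 1 + 2) (m + 1 + 2) + kerP1 b (m + 1) * wzF b (m + 1 + 1) (m + 1 + 2) +
    kerP0 b (m + 1) * wzF b (m + 1) (m + 1 + 2) = wzG b (m + 1) (m + 1 + 2 + 1) - wzG b (m + 1) (m + 1 + 2) := by
  have hN' : (0 : ℚ) ≤ b 0 := by exact_mod_cast hN
  have hQ : 0 < pochQ ((m : ℚ) + 1 + 1 + 1 + b 0 + 1) (m + 1 + 1) := pochQ_pos (by positivity) _
  have hF1 : wzF b (m + 1 + 1) (m + 1 + 2) = 0 := by rw [wzF, if_neg (by omega)]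
  have hF0 : wzF b (m + 1) (m + 1 + 2) = 0 := by rw [wzF, if_neg (by omega)]
  have hG3 : wzG b (m + 1) (m + 1 + 2 + 1) = 0 := by rw [wzG, if_neg (by omega)]
  rw [hF1, hF0, hG3, show m + 1 + 2 = m + 1 + 1 + 1 from rfl, wzF, if_pos ⟨by omega, by omega⟩, wzG, if_pos ⟨by omega, by omega⟩]
  have e1 : m + 1 + 1 + 1 - 1 = m + 1 + 1 := by omega
  have e2 : m + 1 + 1 + 1 - (m + 1 + 1 + 1) = 0 := by omega
  have e3 : m + 1 - 1 = m := by omega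
  simp only [e1, e2, e3, Nat.factorial_succ, Nat.factorial_zero, mul_zero, add_zero, zero_sub, neg_div, neg_neg]
  rw [pochQ_succ_right _ (m + 1 + 1)]
  push_cast
  rw [mul_div_assoc', div_eq_div_iff (by positivity) (by positivity)]
  simp only [kerP2]
  push_cast
  ring

end colone

/-! ### §5 Summation: REC-K -/

/-- The termwise identity on the whole column range `1 ≤ x ≤ μ+2` (`μ ≥ 1`). -/
theorem wz_termwise (b : ℕ → ℤ) (hN : 0 ≤ b 0) (hB : ∀ j ∈ Icc 3 6, 0 ≤ b j ∧ b j ≤ b 0) (μ x : ℕ) (hμ : 1 ≤ μ)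
    (hx : x ∈ Icc 1 (μ + 2)) :
    kerP2 b μ * wzF b (μ + 2) x + kerP1 b μ * wzF b (μ + 1) x + kerP0 b μ * wzF b μ x = wzG b μ (x + 1) - wzG b μ x := by
  simp only [mem_Icc] at hx
  obtain ⟨m, rfl⟩ : ∃ m, μ = m + 1 := ⟨μ - 1, by omega⟩
  rcases Nat.lt_or_ge x (m + 2) with h | h
  · obtain ⟨y, rfl⟩ : ∃ y, x = y + 1 := ⟨x - 1, by omega⟩
    obtain ⟨k, hk⟩ : ∃ k, m + 1 = y + 1 + k := ⟨m - y, by omega⟩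
    rw [hk]
    exact wz_col_interior b hN y k hB
  · rcases Nat.lt_or_ge x (m + 3) with h' | h'
    · obtain rfl : x = m + 1 + 1 := by omega
      exact wz_col_one b hN m hB
    · obtain rfl : x = m + 1 + 2 := by omega
      exact wz_col_two b hN m

/-- The WZ mate vanishes at `x = 1`. -/
theorem wzG_one (b : ℕ → ℤ) (μ : ℕ) : wzG b μ 1 = 0 := by
  rw [wzG, if_pos ⟨le_rfl, by omega⟩]
  simp

/-- Telescoping over `Icc 1 n`. -/
theorem sum_Icc_one_telescope (f : ℕ → ℚ) (n : ℕ) : ∑ x ∈ Icc 1 n, (f (x + 1) - f x) = f (n + 1) - f 1 := by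
  induction n with
  | zero => simp
  | succ n ih => rw [sum_Icc_succ_top (by omega), ih]; ring

/-- **REC-K (PROVED)**: `p₂(μ)·K_{μ+2} + p₁(μ)·K_{μ+1} + p₀(μ)·K_μ = 0` for `μ ≥ 1` (`N ≥ 0`, `0 ≤ b_j ≤ N` on `B`). -/
theorem ldKer_recK (b : ℕ → ℤ) (hN : 0 ≤ b 0) (hB : ∀ j ∈ Icc 3 6, 0 ≤ b j ∧ b j ≤ b 0) (μ : ℕ) (hμ : 1 ≤ μ) :
    kerP2 b μ * ldKer b (μ + 2) + kerP1 b μ * ldKer b (μ + 1) + kerP0 b μ * ldKer b μ = 0 := by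
  rw [ldKer_eq_sum_wzF b (μ + 2) (μ + 2) le_rfl, ldKer_eq_sum_wzF b (μ + 1) (μ + 2) (by omega),
    ldKer_eq_sum_wzF b μ (μ + 2) (by omega), mul_sum, mul_sum, mul_sum, ← sum_add_distrib, ← sum_add_distrib,
    sum_congr rfl fun x hx => wz_termwise b hN hB μ x hμ hx, sum_Icc_one_telescope (wzG b μ) (μ + 2), wzG_one,
    show wzG b μ (μ + 2 + 1) = 0 by rw [wzG, if_neg (by omega)], sub_zero]

/-- STATEMENT (REC-K; PROVED here as `ldKer_recK_holds`): the kernel factor satisfies the order-2 recurrence in `μ`. -/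
def ldKer_recK_stmt : Prop :=
  ∀ b : ℕ → ℤ, 0 ≤ b 0 → (∀ j ∈ Icc 3 6, 0 ≤ b j ∧ b j ≤ b 0) → ∀ μ : ℕ, 1 ≤ μ →
    kerP2 b μ * ldKer b (μ + 2) + kerP1 b μ * ldKer b (μ + 1) + kerP0 b μ * ldKer b μ = 0

/-- REC-K holds. -/
theorem ldKer_recK_holds : ldKer_recK_stmt := fun b hN hB μ hμ => ldKer_recK b hN hB μ hμ

end Summit.KontsevichZagierPeriods.Zeta5Search.WedgeDictionary
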